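import Literature.AlgebraicGeometry.HodgeTheory.AbelianVarietyEndomorphismsHOne
import Literature.AlgebraicGeometry.Motives.AbelianVarietyCohomologyExteriorH1
import Summits.HodgeConjecture.HodgeConjecture.Theorems.WeilTenfoldsSqrtMinus11.Negative.AnchorTyping
import Mathlib.RingTheory.Polynomial.Cyclotomic.Roots
import Mathlib.LinearAlgebra.Eigenspace.Semisimple
import Mathlib.RingTheory.PowerBasis
import HarnessLib

/-!
# Crux `WeilTenfoldsSqrtMinus11` (stmt-HodgeConjecture-1262), line `quaternionic-norm-anchors` —
# norm anchors, part 1: `H¹ = ⊕_{j<10} U_j` into ten PLANES under an order-11 `ψ`, and the Gauss sum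

Lead `prover-line-stmt-HodgeConjecture-1262-c1-0`, 2026-08-16. Sorry-free, standard axioms, no definitions
(local notation only). For a complex abelian TENFOLD `A` and `ψ : A ⟶ A` with `ψ¹¹ = 𝟙`, `Σ_{k<11} ψᵏ = 0`
in `End A` (the endomorphism clauses of the skeleton's `IsNormAnchor`, `Lines/quaternionic-norm-anchors.lean`):
* §1 `f ↦ f^*|_{H¹}` is additive, unital, power-preserving (`exists_pullOne`, from the tree's
  `complexBetti_map_add_one`), so `(ψ^*)¹¹ = 1`, `Σ(ψ^*)ᵏ = 0`;
* §2 `ψ^*` is semisimple with primitive-11th-root eigenvalues: `H¹ = ⊕_{j<10} ker(ψ^* - ζ^{j+1})`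
  (`isInternal_U`);
* §3 each summand is a PLANE (`finrank_U`): `tr ψ^*` is rational (`trace_map_one_mem_range_ratCast`) and
  `1, ζ, …, ζ⁹` are `ℚ`-independent (`cyclotomic_eq_minpoly_rat`), `b₁ = 20`
  (`abelianVarietyCohomologyExteriorH1_holds`);
* §4 the Gauss sum `φ = g(ψ)` acts on `ker(ψ^* - u)` by `g(u) = ± i√11` (landed `gaussSum11_sq`) and
  `φ ≫ φ = -11`;
* §5b a bookkeeping equivalence `Fin (10+10) ≃ Σ j, Fin 2` listing five chosen planes first.
Consumed by part 2 (`…NormAnchorWeilClasses`: the Weil plane of `(A, φ)` is algebraic).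

References: [LangeBirkenhake1992] §1.1 (Prop. 1.1.9), §13.1; [vanGeemen1994HodgeAV] LNM 1594, 4.8–4.9, proof of Lemma 5.2.
-/

noncomputable section

set_option linter.dupNamespace false

open CategoryTheory AlgebraicGeometry Complex Polynomial
open Literature.AlgebraicGeometry.Motives Literature.AlgebraicGeometry.HodgeTheory
open Literature.AlgebraicTopology.SingularHomology
open Summit.HodgeConjecture.HodgeConjecture.Theorems.WeilTenfoldsSqrtMinus11.Negative

namespace Summit.HodgeConjecture.HodgeConjecture.Theorems.HeckePrymWeil

namespace NormAnchor

variable {A : AbelianVariety ℂ}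
/-! ### §1 Pull-back on `H¹` is a ring anti-homomorphism `End A → End_ℂ H¹` -/

/-- **The pull-back `f ↦ f^*|_{H¹(A(ℂ);ℂ)}` is an additive, unital, power-preserving map
`End A → End_ℂ H¹`** (additivity: the tree's `complexBetti_map_add_one`; `(g ≫ f)^* = g^* ∘ f^*`).
Stated as an existence so that no definition is introduced. [cite: LangeBirkenhake1992, §1.1 (p. 19)] -/
theorem exists_pullOne (A : AbelianVariety ℂ) :
    ∃ P : CategoryTheory.End A →+ Module.End ℂ (complexBetti A.X 1),
      (∀ f : A ⟶ A, P (CategoryTheory.End.of f) = (complexBetti.map f.hom.hom.hom 1).hom) ∧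
      P 1 = 1 ∧ (∀ f : CategoryTheory.End A, ∀ k : ℕ, P (f ^ k) = P f ^ k) := by
  let P : CategoryTheory.End A →+ Module.End ℂ (complexBetti A.X 1) :=
    { toFun := fun f => (complexBetti.map (show A ⟶ A from f).hom.hom.hom 1).hom
      map_zero' := by
        change (complexBetti.map (0 : A ⟶ A).hom.hom.hom 1).hom = 0
        rw [complexBetti_map_zero_one]; rfl
      map_add' := fun f g => by
        change (complexBetti.map ((show A ⟶ A from f) + (show A ⟶ A from g)).hom.hom.hom 1).hom = _
        rw [complexBetti_map_add_one]; rfl }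
  have h1 : P 1 = 1 := by
    change (complexBetti.map (𝟙 A.X) 1).hom = _
    rw [complexBetti.map_id]; rfl
  have hmul : ∀ f g : CategoryTheory.End A, P (f * g) = P g * P f := fun f g => by
    change (complexBetti.map ((show A ⟶ A from g).hom.hom.hom ≫ (show A ⟶ A from f).hom.hom.hom) 1).hom = _
    rw [complexBetti.map_comp]; rfl
  have hpow : ∀ (f : CategoryTheory.End A) (k : ℕ), P (f ^ k) = P f ^ k := fun f k => by
    induction k with
    | zero => rw [pow_zero, pow_zero]; exact h1
    | succ k ih => rw [pow_succ, hmul, ih, ← pow_succ']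
  exact ⟨P, fun f => rfl, h1, hpow⟩

/-! ### §2 `ψ^*` of order `11` with vanishing norm: `H¹ = ⊕_{j<10} U_{ζ^{j+1}}` -/

/-- `(Complex.exp (2 * (Real.pi : ℂ) * Complex.I / 11)) = exp(2πi/11)` is a primitive 11th root of unity. [folklore] -/
theorem zeta_isPrimitiveRoot : IsPrimitiveRoot (Complex.exp (2 * (Real.pi : ℂ) * Complex.I / 11)) 11 := Complex.isPrimitiveRoot_exp 11 (by norm_num)

section Eigen

variable {ψ : A ⟶ A}

/-- `(ψ^*)¹¹ = 1` on `H¹` for `ψ¹¹ = 𝟙`. [folklore] -/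
theorem pb_pow_eleven (h11 : (CategoryTheory.End.of ψ) ^ 11 = 1) : (complexBetti.map ψ.hom.hom.hom 1).hom ^ 11 = 1 := by
  obtain ⟨P, hP, h1, hpow⟩ := exists_pullOne A
  have h := congrArg P h11
  rw [hpow, h1, hP] at h
  exact h

/-- `Σ_{k<11} (ψ^*)ᵏ = 0` on `H¹` for `Σ_{k<11} ψᵏ = 0` (additivity of `f ↦ f^*|_{H¹}`). [folklore] -/
theorem sum_pb_pow (hnorm : (Finset.range 11).sum (fun k => (CategoryTheory.End.of ψ) ^ k) = 0) :
    (Finset.range 11).sum (fun k => (complexBetti.map ψ.hom.hom.hom 1).hom ^ k) = 0 := by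
  obtain ⟨P, hP, -, hpow⟩ := exists_pullOne A
  have h := congrArg P hnorm
  rw [map_sum, map_zero] at h
  simp only [hpow] at h
  simp only [hP] at h
  exact h

/-- `(ψ^*)ᵏ v = μᵏ v` on an eigenvector. [folklore] -/
theorem pb_pow_apply_of_mem_eigenspace {μ : ℂ} {v : complexBetti A.X 1}
    (hv : v ∈ Module.End.eigenspace (complexBetti.map ψ.hom.hom.hom 1).hom μ) (k : ℕ) : ((complexBetti.map ψ.hom.hom.hom 1).hom ^ k) v = μ ^ k • v := by
  rw [Module.End.mem_eigenspace_iff] at hv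
  induction k with
  | zero => simp
  | succ k ih => rw [pow_succ, Module.End.mul_apply, hv, map_smul, ih, smul_smul, ← pow_succ']

/-- `ψ^*|_{H¹}` is semisimple (it is killed by the separable polynomial `X¹¹ - 1`). [folklore] -/
theorem pb_isSemisimple (h11 : (CategoryTheory.End.of ψ) ^ 11 = 1) : Module.End.IsSemisimple (complexBetti.map ψ.hom.hom.hom 1).hom := by
  refine Module.End.isSemisimple_of_squarefree_aeval_eq_zero (p := X ^ 11 - C 1) ?_ ?_
  · exact (separable_X_pow_sub_C (1 : ℂ) (by norm_num) one_ne_zero).squarefree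
  · simp only [map_sub, map_pow, aeval_X, map_one, pb_pow_eleven h11, sub_self]

/-- An eigenvalue of `ψ^*|_{H¹}` is an 11th root of unity different from `1`. [folklore] -/
theorem eigenvalue_pow_eleven (h11 : (CategoryTheory.End.of ψ) ^ 11 = 1)
    (hnorm : (Finset.range 11).sum (fun k => (CategoryTheory.End.of ψ) ^ k) = 0)
    {μ : ℂ} (hμ : Module.End.eigenspace (complexBetti.map ψ.hom.hom.hom 1).hom μ ≠ ⊥) : μ ^ 11 = 1 ∧ μ ≠ 1 := by
  obtain ⟨v, hv, hv0⟩ := (Submodule.ne_bot_iff _).mp hμ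
  have hpow := pb_pow_apply_of_mem_eigenspace hv
  constructor
  · have h := hpow 11
    rw [pb_pow_eleven h11, Module.End.one_apply] at h
    have h' : (μ ^ 11 - 1) • v = 0 := by rw [sub_smul, one_smul, ← h, sub_self]
    exact sub_eq_zero.mp ((smul_eq_zero.mp h').resolve_right hv0)
  · rintro rfl
    have h := LinearMap.congr_fun (sum_pb_pow hnorm) v
    rw [LinearMap.sum_apply, LinearMap.zero_apply] at h
    simp only [hpow, one_pow, one_smul, Finset.sum_const, Finset.card_range] at h
    rw [← Nat.cast_smul_eq_nsmul ℂ] at h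
    exact hv0 ((smul_eq_zero.mp h).resolve_left (by norm_num))

/-- The eigenvalues `ζ^{j+1}`, `j < 10`, are pairwise distinct. [folklore] -/
theorem zeta_pow_succ_injective : Function.Injective fun j : Fin 10 => (Complex.exp (2 * (Real.pi : ℂ) * Complex.I / 11)) ^ ((j : ℕ) + 1) := by
  intro i j h
  have := zeta_isPrimitiveRoot.pow_inj (i := (i : ℕ) + 1) (j := (j : ℕ) + 1) (by omega) (by omega) h
  exact Fin.ext (by omega)

/-- **`H¹ = ⊕_{j<10} U_j`** (internal direct sum): `ψ^*` is semisimple, every eigenvalue is a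
primitive 11th root `ζ^{j+1}`, and eigenspaces for distinct eigenvalues are independent.
[cite: LangeBirkenhake1992, §13.1] -/
theorem isInternal_U (h11 : (CategoryTheory.End.of ψ) ^ 11 = 1)
    (hnorm : (Finset.range 11).sum (fun k => (CategoryTheory.End.of ψ) ^ k) = 0) :
    DirectSum.IsInternal ((fun j : Fin 10 => (Module.End.eigenspace (complexBetti.map ψ.hom.hom.hom 1).hom ((Complex.exp (2 * (Real.pi : ℂ) * Complex.I / 11)) ^ (((j : Fin 10) : ℕ) + 1))))) := by
  haveI := finite_complexBetti_abelianVariety A 1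
  refine DirectSum.isInternal_submodule_of_iSupIndep_of_iSup_eq_top ?_ ?_
  · exact (Module.End.eigenspaces_iSupIndep ((complexBetti.map ψ.hom.hom.hom 1).hom)).comp zeta_pow_succ_injective
  · refine top_le_iff.mp ?_
    rw [← (pb_isSemisimple h11).iSup_eigenspace_eq_top]
    refine iSup_le fun μ => ?_
    by_cases hμ : Module.End.eigenspace (complexBetti.map ψ.hom.hom.hom 1).hom μ = ⊥
    · rw [hμ]; exact bot_le
    · obtain ⟨h1, h2⟩ := eigenvalue_pow_eleven h11 hnorm hμ
      haveI : NeZero (11 : ℕ) := ⟨by norm_num⟩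
      obtain ⟨i, hi, hiμ⟩ := zeta_isPrimitiveRoot.eq_pow_of_pow_eq_one h1
      have hi0 : i ≠ 0 := by rintro rfl; exact h2 (by rw [← hiμ, pow_zero])
      have hle : Module.End.eigenspace (complexBetti.map ψ.hom.hom.hom 1).hom μ ≤ (Module.End.eigenspace (complexBetti.map ψ.hom.hom.hom 1).hom ((Complex.exp (2 * (Real.pi : ℂ) * Complex.I / 11)) ^ (((⟨i - 1, by omega⟩ : Fin 10) : ℕ) + 1))) := by
        rw [← hiμ]
        have : (((⟨i - 1, by omega⟩ : Fin 10) : ℕ) + 1) = i := by change i - 1 + 1 = i; omega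
        rw [this]
      exact hle.trans (le_iSup ((fun j : Fin 10 => (Module.End.eigenspace (complexBetti.map ψ.hom.hom.hom 1).hom ((Complex.exp (2 * (Real.pi : ℂ) * Complex.I / 11)) ^ (((j : Fin 10) : ℕ) + 1))))) _)

end Eigen

/-! ### §3 Multiplicities: every `U_j` is a PLANE (`tr ψ^* ∈ ℚ` and `[ℚ((Complex.exp (2 * (Real.pi : ℂ) * Complex.I / 11))):ℚ] = 10`) -/

section Multiplicity

variable {ψ : A ⟶ A}

/-- `Σ_{i<11} ζ^i = 0`. [folklore] -/
theorem sum_zeta_pow : (Finset.range 11).sum (fun i => (Complex.exp (2 * (Real.pi : ℂ) * Complex.I / 11)) ^ i) = 0 :=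
  zeta_isPrimitiveRoot.geom_sum_eq_zero (by norm_num)

/-- The powers `1, ζ, …, ζ⁹` are linearly independent over `ℚ` (`[ℚ((Complex.exp (2 * (Real.pi : ℂ) * Complex.I / 11))):ℚ] = φ(11) = 10`).
[folklore] -/
theorem linearIndependent_zeta_pow :
    LinearIndependent ℚ fun i : Fin 10 => (Complex.exp (2 * (Real.pi : ℂ) * Complex.I / 11)) ^ (i : ℕ) := by
  have hdeg : (minpoly ℚ (Complex.exp (2 * (Real.pi : ℂ) * Complex.I / 11))).natDegree = 10 := by
    rw [← cyclotomic_eq_minpoly_rat zeta_isPrimitiveRoot (by norm_num), natDegree_cyclotomic,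
      Nat.totient_prime (by norm_num)]
  have h := linearIndependent_pow (K := ℚ) (Complex.exp (2 * (Real.pi : ℂ) * Complex.I / 11))
  rw [hdeg] at h
  exact h

/-- If natural numbers `d₀,…,d₉` and a rational `q` satisfy `Σ_{j<10} d_j ζ^{j+1} = q`, then all `d_j`
are equal (compare coefficients in the `ℚ`-basis `1, ζ, …, ζ⁹`, using `ζ¹⁰ = -(1 + ⋯ + ζ⁹)`).
[folklore] -/
theorem eq_of_sum_mul_zeta_pow_eq_ratCast (d : ℕ → ℕ) (q : ℚ)
    (h : ∑ j ∈ Finset.range 10, (d j : ℂ) * (Complex.exp (2 * (Real.pi : ℂ) * Complex.I / 11)) ^ (j + 1) = q) : ∀ j < 10, d j = d 9 := by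
  -- the coefficient vector of `(T - q) - d₉ · (1 + ζ + ⋯ + ζ¹⁰)` in the basis `ζ⁰, …, ζ⁹`
  let cn : ℕ → ℚ := fun i => if i = 0 then -(d 9 : ℚ) - q else (d (i - 1) : ℚ) - d 9
  have hG := sum_zeta_pow
  have hc : ∑ i : Fin 10, cn i • (Complex.exp (2 * (Real.pi : ℂ) * Complex.I / 11)) ^ (i : ℕ) = 0 := by
    rw [Fin.sum_univ_eq_sum_range (fun i => cn i • (Complex.exp (2 * (Real.pi : ℂ) * Complex.I / 11)) ^ i) 10]
    simp only [cn, Algebra.smul_def]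
    simp only [Finset.sum_range_succ, Finset.sum_range_zero] at h hG ⊢
    norm_num at h hG ⊢
    linear_combination h - (d 9 : ℂ) * hG
  have hzero := fun i => (Fintype.linearIndependent_iff.mp linearIndependent_zeta_pow (fun i => cn i) hc i)
  intro j hj
  by_cases hj9 : j = 9
  · rw [hj9]
  · have h1 := hzero ⟨j + 1, by omega⟩
    simp only [cn, Nat.succ_ne_zero, ↓reduceIte, Nat.add_one_sub_one, sub_eq_zero, Nat.cast_inj] at h1
    exact h1

/-- **Every eigenspace `U_j` of `ψ^*|_{H¹}` has dimension `2`** on an abelian TENFOLD with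
`ψ¹¹ = 𝟙`, `Σ_{k<11} ψᵏ = 0`: the trace `Σ_j ζ^{j+1} dim U_j` of `ψ^*` is rational
(`trace_map_one_mem_range_ratCast`), so the ten multiplicities are equal, and they sum to
`b₁ = 20`. [cite: LangeBirkenhake1992, §13.1 and Prop. 1.1.9] -/
theorem finrank_U (hA : A.dim = 10) (h11 : (CategoryTheory.End.of ψ) ^ 11 = 1)
    (hnorm : (Finset.range 11).sum (fun k => (CategoryTheory.End.of ψ) ^ k) = 0) (j : Fin 10) :
    Module.finrank ℂ ((Module.End.eigenspace (complexBetti.map ψ.hom.hom.hom 1).hom ((Complex.exp (2 * (Real.pi : ℂ) * Complex.I / 11)) ^ (((j : Fin 10) : ℕ) + 1)))) = 2 := by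
  classical
  haveI := finite_complexBetti_abelianVariety A 1
  have hN := isInternal_U h11 hnorm
  -- multiplicities as a function on `ℕ`
  let d : ℕ → ℕ := fun i => if hi : i < 10 then Module.finrank ℂ ((Module.End.eigenspace (complexBetti.map ψ.hom.hom.hom 1).hom ((Complex.exp (2 * (Real.pi : ℂ) * Complex.I / 11)) ^ (((⟨i, hi⟩ : Fin 10) : ℕ) + 1)))) else 0
  have hdj : ∀ i : Fin 10, Module.finrank ℂ ((Module.End.eigenspace (complexBetti.map ψ.hom.hom.hom 1).hom ((Complex.exp (2 * (Real.pi : ℂ) * Complex.I / 11)) ^ (((i : Fin 10) : ℕ) + 1)))) = d i := fun i => by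
    simp only [d, i.2, ↓reduceDIte]
  -- `Σ_j d_j = 20`
  have hsum : ∑ i ∈ Finset.range 10, d i = 20 := by
    have hb := hN.collectedBasis fun j => Module.finBasis ℂ ((Module.End.eigenspace (complexBetti.map ψ.hom.hom.hom 1).hom ((Complex.exp (2 * (Real.pi : ℂ) * Complex.I / 11)) ^ (((j : Fin 10) : ℕ) + 1))))
    have h1 := Module.finrank_eq_card_basis hb
    rw [Fintype.card_sigma] at h1
    simp only [Fintype.card_fin] at h1
    rw [abelianVarietyCohomologyExteriorH1_holds.finrank_one A, hA] at h1
    rw [← Fin.sum_univ_eq_sum_range d 10]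
    have : ∑ i : Fin 10, d ↑i = ∑ i : Fin 10, Module.finrank ℂ ((Module.End.eigenspace (complexBetti.map ψ.hom.hom.hom 1).hom ((Complex.exp (2 * (Real.pi : ℂ) * Complex.I / 11)) ^ (((i : Fin 10) : ℕ) + 1)))) :=
      Finset.sum_congr rfl fun i _ => (hdj i).symm
    rw [this]
    simpa using h1.symm
  -- `tr ψ^* = Σ_j ζ^{j+1} d_j`
  have hmaps : ∀ j, Set.MapsTo ((complexBetti.map ψ.hom.hom.hom 1).hom) ((Module.End.eigenspace (complexBetti.map ψ.hom.hom.hom 1).hom ((Complex.exp (2 * (Real.pi : ℂ) * Complex.I / 11)) ^ (((j : Fin 10) : ℕ) + 1)))) ((Module.End.eigenspace (complexBetti.map ψ.hom.hom.hom 1).hom ((Complex.exp (2 * (Real.pi : ℂ) * Complex.I / 11)) ^ (((j : Fin 10) : ℕ) + 1)))) := fun j => mapsTo_eigenspace ψ _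
  have htr := LinearMap.trace_eq_sum_trace_restrict hN hmaps
  have htr' : LinearMap.trace ℂ _ ((complexBetti.map ψ.hom.hom.hom 1).hom) = ∑ j ∈ Finset.range 10, (d j : ℂ) * (Complex.exp (2 * (Real.pi : ℂ) * Complex.I / 11)) ^ (j + 1) := by
    rw [htr, ← Fin.sum_univ_eq_sum_range (fun j => (d j : ℂ) * (Complex.exp (2 * (Real.pi : ℂ) * Complex.I / 11)) ^ (j + 1)) 10]
    refine Finset.sum_congr rfl fun j _ => ?_
    rw [trace_restrict_eigenspace ψ, mul_comm, hdj]
  obtain ⟨q, hq⟩ := trace_map_one_mem_range_ratCast ψ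
  change (q : ℂ) = LinearMap.trace ℂ _ ((complexBetti.map ψ.hom.hom.hom 1).hom) at hq
  rw [htr'] at hq
  have heq := eq_of_sum_mul_zeta_pow_eq_ratCast d q hq.symm
  have h9 : d 9 = 2 := by
    have : ∑ i ∈ Finset.range 10, d i = ∑ _i ∈ Finset.range 10, d 9 :=
      Finset.sum_congr rfl fun i hi => heq i (Finset.mem_range.mp hi)
    rw [this, Finset.sum_const, Finset.card_range, smul_eq_mul] at hsum
    omega
  rw [hdj, heq j j.2, h9]

end Multiplicity
/-! ### §4 The Gauss sum: `φ = g(ψ)`, `φ^* = g(u)` on `U_u`, `g(u) = ± i√11`, and `φ ≫ φ = -11` -/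

section Gauss

variable {ψ φ : A ⟶ A}

/-- `φ^* = g(ψ^*)` on `H¹` (additivity of pull-back on `H¹` and `(ψᵏ)^* = (ψ^*)ᵏ`). [folklore] -/
theorem pb_eq_gval (hφ : ((CategoryTheory.End.of φ) = (CategoryTheory.End.of ψ) + (CategoryTheory.End.of ψ) ^ 3 + (CategoryTheory.End.of ψ) ^ 4 + (CategoryTheory.End.of ψ) ^ 5 + (CategoryTheory.End.of ψ) ^ 9 - (CategoryTheory.End.of ψ) ^ 2 - (CategoryTheory.End.of ψ) ^ 6 - (CategoryTheory.End.of ψ) ^ 7 - (CategoryTheory.End.of ψ) ^ 8 - (CategoryTheory.End.of ψ) ^ 10)) :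
    (complexBetti.map φ.hom.hom.hom 1).hom = (complexBetti.map ψ.hom.hom.hom 1).hom + (complexBetti.map ψ.hom.hom.hom 1).hom ^ 3 + (complexBetti.map ψ.hom.hom.hom 1).hom ^ 4 + (complexBetti.map ψ.hom.hom.hom 1).hom ^ 5 + (complexBetti.map ψ.hom.hom.hom 1).hom ^ 9 -
      (complexBetti.map ψ.hom.hom.hom 1).hom ^ 2 - (complexBetti.map ψ.hom.hom.hom 1).hom ^ 6 - (complexBetti.map ψ.hom.hom.hom 1).hom ^ 7 - (complexBetti.map ψ.hom.hom.hom 1).hom ^ 8 - (complexBetti.map ψ.hom.hom.hom 1).hom ^ 10 := by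
  obtain ⟨P, hP, -, hpow⟩ := exists_pullOne A
  have h := congrArg P hφ
  simp only [map_add, map_sub, hpow] at h
  simp only [hP] at h
  exact h

/-- On the eigenspace `ker(ψ^* - u)` the Gauss sum `φ^*` acts by the scalar `g(u)`. [folklore] -/
theorem pb_apply_of_mem_eigenspace (hφ : ((CategoryTheory.End.of φ) = (CategoryTheory.End.of ψ) + (CategoryTheory.End.of ψ) ^ 3 + (CategoryTheory.End.of ψ) ^ 4 + (CategoryTheory.End.of ψ) ^ 5 + (CategoryTheory.End.of ψ) ^ 9 - (CategoryTheory.End.of ψ) ^ 2 - (CategoryTheory.End.of ψ) ^ 6 - (CategoryTheory.End.of ψ) ^ 7 - (CategoryTheory.End.of ψ) ^ 8 - (CategoryTheory.End.of ψ) ^ 10)) {u : ℂ} {v : complexBetti A.X 1}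
    (hv : v ∈ Module.End.eigenspace (complexBetti.map ψ.hom.hom.hom 1).hom u) : (complexBetti.map φ.hom.hom.hom 1).hom v = (u + u ^ 3 + u ^ 4 + u ^ 5 + u ^ 9 - u ^ 2 - u ^ 6 - u ^ 7 - u ^ 8 - u ^ 10) • v := by
  have hp := pb_pow_apply_of_mem_eigenspace hv
  have h1 : (complexBetti.map ψ.hom.hom.hom 1).hom v = u • v := by simpa using hp 1
  rw [pb_eq_gval hφ]
  simp only [LinearMap.sub_apply, LinearMap.add_apply, hp, h1]
  simp only [add_smul, sub_smul]

/-- `ker(ψ^* - u) ≤ ker(φ^* - g(u))`. [folklore] -/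
theorem eigenspace_le_eigenspace_gval (hφ : ((CategoryTheory.End.of φ) = (CategoryTheory.End.of ψ) + (CategoryTheory.End.of ψ) ^ 3 + (CategoryTheory.End.of ψ) ^ 4 + (CategoryTheory.End.of ψ) ^ 5 + (CategoryTheory.End.of ψ) ^ 9 - (CategoryTheory.End.of ψ) ^ 2 - (CategoryTheory.End.of ψ) ^ 6 - (CategoryTheory.End.of ψ) ^ 7 - (CategoryTheory.End.of ψ) ^ 8 - (CategoryTheory.End.of ψ) ^ 10)) (u : ℂ) :
    Module.End.eigenspace (complexBetti.map ψ.hom.hom.hom 1).hom u ≤ Module.End.eigenspace (complexBetti.map φ.hom.hom.hom 1).hom ((u + u ^ 3 + u ^ 4 + u ^ 5 + u ^ 9 - u ^ 2 - u ^ 6 - u ^ 7 - u ^ 8 - u ^ 10)) := fun _ hv =>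
  Module.End.mem_eigenspace_iff.mpr (pb_apply_of_mem_eigenspace hφ hv)

/-- `g(ζ^{j+1})² = -11` for `j < 10` (the Gauss sum of a primitive 11th root of unity; the tree's
ring identity `gaussSum11_sq` with `Σ_{k<11} u^k = 0`). [folklore] -/
theorem gval_mul_self (j : Fin 10) :
    (((Complex.exp (2 * (Real.pi : ℂ) * Complex.I / 11)) ^ ((j : ℕ) + 1)) + ((Complex.exp (2 * (Real.pi : ℂ) * Complex.I / 11)) ^ ((j : ℕ) + 1)) ^ 3 + ((Complex.exp (2 * (Real.pi : ℂ) * Complex.I / 11)) ^ ((j : ℕ) + 1)) ^ 4 + ((Complex.exp (2 * (Real.pi : ℂ) * Complex.I / 11)) ^ ((j : ℕ) + 1)) ^ 5 + ((Complex.exp (2 * (Real.pi : ℂ) * Complex.I / 11)) ^ ((j : ℕ) + 1)) ^ 9 - ((Complex.exp (2 * (Real.pi : ℂ) * Complex.I / 11)) ^ ((j : ℕ) + 1)) ^ 2 - ((Complex.exp (2 * (Real.pi : ℂ) * Complex.I / 11)) ^ ((j : ℕ) + 1)) ^ 6 - ((Complex.exp (2 * (Real.pi : ℂ) * Complex.I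 / 11)) ^ ((j : ℕ) + 1)) ^ 7 - ((Complex.exp (2 * (Real.pi : ℂ) * Complex.I / 11)) ^ ((j : ℕ) + 1)) ^ 8 - ((Complex.exp (2 * (Real.pi : ℂ) * Complex.I / 11)) ^ ((j : ℕ) + 1)) ^ 10) * (((Complex.exp (2 * (Real.pi : ℂ) * Complex.I / 11)) ^ ((j : ℕ) + 1)) + ((Complex.exp (2 * (Real.pi : ℂ) * Complex.I / 11)) ^ ((j : ℕ) + 1)) ^ 3 + ((Complex.exp (2 * (Real.pi : ℂ) * Complex.I / 11)) ^ ((j : ℕ) + 1)) ^ 4 + ((Complex.exp (2 * (Real.pi : ℂ) * Complex.I / 11)) ^ ((j : ℕ) + 1)) ^ 5 + ((Complex.exp (2 * (Real.pi : ℂ) * Complex.I / 11)) ^ ((j : ℕ) + 1)) ^ 9 - ((Complex.exp (2 * (Real.pi : ℂ) * Complex.I / 11)) ^ ((j : ℕ) + 1)) ^ 2 - ((Complex.exp (2 * (Real.pi : ℂ) * Complex.I / 11)) ^ ((j : ℕ) + 1)) ^ 6 - ((Complex.exp (2 * (Real.pi : ℂ) * Complex.I / 11)) ^ ((j : ℕ)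 + 1)) ^ 7 - ((Complex.exp (2 * (Real.pi : ℂ) * Complex.I / 11)) ^ ((j : ℕ) + 1)) ^ 8 - ((Complex.exp (2 * (Real.pi : ℂ) * Complex.I / 11)) ^ ((j : ℕ) + 1)) ^ 10) = -11 := by
  set u := (Complex.exp (2 * (Real.pi : ℂ) * Complex.I / 11)) ^ ((j : ℕ) + 1) with hu
  have hprim : IsPrimitiveRoot u 11 :=
    zeta_isPrimitiveRoot.pow_of_coprime _ (Nat.Coprime.symm
      (Nat.coprime_of_lt_prime (by omega) (by omega) (by norm_num)))
  have h11 : u ^ 11 = 1 := hprim.pow_eq_one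
  have hsum : (Finset.range 11).sum (fun k => u ^ k) = 0 := hprim.geom_sum_eq_zero (by norm_num)
  have h := gaussSum11_sq u h11
  rw [hsum, add_zero] at h
  exact h

/-- Hence `g(ζ^{j+1}) = i√11` or `g(ζ^{j+1}) = -i√11`. [folklore] -/
theorem gval_eq_or (j : Fin 10) :
    (((Complex.exp (2 * (Real.pi : ℂ) * Complex.I / 11)) ^ ((j : ℕ) + 1)) + ((Complex.exp (2 * (Real.pi : ℂ) * Complex.I / 11)) ^ ((j : ℕ) + 1)) ^ 3 + ((Complex.exp (2 * (Real.pi : ℂ) * Complex.I / 11)) ^ ((j : ℕ) + 1)) ^ 4 + ((Complex.exp (2 * (Real.pi : ℂ) * Complex.I / 11)) ^ ((j : ℕ) + 1)) ^ 5 + ((Complex.exp (2 * (Real.pi : ℂ) * Complex.I / 11)) ^ ((j : ℕ) + 1)) ^ 9 - ((Complex.exp (2 * (Real.pi : ℂ) * Complex.I / 11)) ^ ((j : ℕ) + 1)) ^ 2 - ((Complex.exp (2 * (Real.pi : ℂ) * Complex.I / 11)) ^ ((j : ℕ) + 1)) ^ 6 - ((Complex.exp (2 * (Real.pi : ℂ)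 * Complex.I / 11)) ^ ((j : ℕ) + 1)) ^ 7 - ((Complex.exp (2 * (Real.pi : ℂ) * Complex.I / 11)) ^ ((j : ℕ) + 1)) ^ 8 - ((Complex.exp (2 * (Real.pi : ℂ) * Complex.I / 11)) ^ ((j : ℕ) + 1)) ^ 10) = Complex.I * (Real.sqrt (11 : ℕ) : ℂ) ∨
      (((Complex.exp (2 * (Real.pi : ℂ) * Complex.I / 11)) ^ ((j : ℕ) + 1)) + ((Complex.exp (2 * (Real.pi : ℂ) * Complex.I / 11)) ^ ((j : ℕ) + 1)) ^ 3 + ((Complex.exp (2 * (Real.pi : ℂ) * Complex.I / 11)) ^ ((j : ℕ) + 1)) ^ 4 + ((Complex.exp (2 * (Real.pi : ℂ) * Complex.I / 11)) ^ ((j : ℕ) + 1)) ^ 5 + ((Complex.exp (2 * (Real.pi : ℂ) * Complex.I / 11)) ^ ((j : ℕ) + 1)) ^ 9 - ((Complex.exp (2 * (Real.pi : ℂ) * Complex.I / 11)) ^ ((j : ℕ) + 1)) ^ 2 - ((Complex.exp (2 * (Real.pi : ℂ) * Complex.I / 11)) ^ ((j : ℕ) + 1)) ^ 6 - ((Complex.exp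 (2 * (Real.pi : ℂ) * Complex.I / 11)) ^ ((j : ℕ) + 1)) ^ 7 - ((Complex.exp (2 * (Real.pi : ℂ) * Complex.I / 11)) ^ ((j : ℕ) + 1)) ^ 8 - ((Complex.exp (2 * (Real.pi : ℂ) * Complex.I / 11)) ^ ((j : ℕ) + 1)) ^ 10) = -(Complex.I * (Real.sqrt (11 : ℕ) : ℂ)) := by
  apply mul_self_eq_mul_self_iff.mp
  rw [gval_mul_self, ← sq, I_mul_sqrt_sq]
  norm_num

/-- **`φ ≫ φ = -11`** for the Gauss sum `φ = g(ψ)` of `ψ` with `ψ¹¹ = 1`, `Σ_{k<11} ψᵏ = 0`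
(the ring identity `g(z)² = -11 + Σ zᵏ` in `End A`). [folklore] -/
theorem comp_self_of_isGaussSumOf (hφ : ((CategoryTheory.End.of φ) = (CategoryTheory.End.of ψ) + (CategoryTheory.End.of ψ) ^ 3 + (CategoryTheory.End.of ψ) ^ 4 + (CategoryTheory.End.of ψ) ^ 5 + (CategoryTheory.End.of ψ) ^ 9 - (CategoryTheory.End.of ψ) ^ 2 - (CategoryTheory.End.of ψ) ^ 6 - (CategoryTheory.End.of ψ) ^ 7 - (CategoryTheory.End.of ψ) ^ 8 - (CategoryTheory.End.of ψ) ^ 10)) (h11 : (CategoryTheory.End.of ψ) ^ 11 = 1)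
    (hnorm : (Finset.range 11).sum (fun k => (CategoryTheory.End.of ψ) ^ k) = 0) : φ ≫ φ = -(11 • 𝟙 A) := by
  have h := gaussSum11_sq ((CategoryTheory.End.of ψ)) h11
  rw [hnorm, add_zero, ← hφ] at h
  -- `h : (CategoryTheory.End.of φ) * (CategoryTheory.End.of φ) = -11` in the ring `End A`, whose product is `f * g = g ≫ f`
  have h2 : (CategoryTheory.End.of φ) * (CategoryTheory.End.of φ) = -((11 : ℕ) • (1 : CategoryTheory.End A)) := by
    rw [h, nsmul_one, Nat.cast_ofNat]
  exact h2

end Gauss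
/-! ### §5b Bookkeeping: an index equivalence listing the five `+`-planes first -/

/-- For a 5-element set `S` of the ten plane-indices there is a bijection
`Fin (10+10) ≃ Σ j, Fin 2` whose first ten values run through the pairs `(j, 0), (j, 1)`, `j ∈ S`,
consecutively. [folklore] -/
theorem exists_pairIndexEquiv (S : Finset (Fin 10)) (hS5 : S.card = 5) :
    ∃ τ : Fin (10 + 10) ≃ (Σ _ : Fin 10, Fin 2),
      (∀ k : Fin 10, (τ (Fin.castAdd 10 k)).1 ∈ S) ∧
      ∀ a : Fin 5, (τ (Fin.castAdd 10 ⟨2 * (a : ℕ), by omega⟩)).1 =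
        (τ (Fin.castAdd 10 ⟨2 * (a : ℕ) + 1, by omega⟩)).1 := by
  classical
  have hcp : Fintype.card {j : Fin 10 // j ∈ S} = 5 := by rw [Fintype.card_coe, hS5]
  have hcm : Fintype.card {j : Fin 10 // ¬ j ∈ S} = 5 := by
    rw [Fintype.card_subtype_compl, Fintype.card_fin, hcp]
  let ep : Fin 5 ≃ {j : Fin 10 // j ∈ S} := (Fintype.equivFinOfCardEq hcp).symm
  let em : Fin 5 ≃ {j : Fin 10 // ¬ j ∈ S} := (Fintype.equivFinOfCardEq hcm).symm
  let fpf : Fin 5 × Fin 2 ≃ Fin 10 := finProdFinEquiv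
  let τ : Fin (10 + 10) ≃ (Σ _j : Fin 10, Fin 2) :=
    finSumFinEquiv.symm.trans <|
      (Equiv.sumCongr (fpf.symm.trans (ep.prodCongr (Equiv.refl (Fin 2))))
          (fpf.symm.trans (em.prodCongr (Equiv.refl (Fin 2))))).trans <|
        (Equiv.sumProdDistrib _ _ (Fin 2)).symm.trans <|
          (Equiv.prodCongr (Equiv.sumCompl fun j : Fin 10 => j ∈ S) (Equiv.refl (Fin 2))).trans
            (Equiv.sigmaEquivProd (Fin 10) (Fin 2)).symm
  have hτ : ∀ k : Fin 10, τ (Fin.castAdd 10 k) =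
      ⟨((ep (fpf.symm k).1 : {j // j ∈ S}) : Fin 10), (fpf.symm k).2⟩ := by
    intro k
    change (Equiv.sigmaEquivProd (Fin 10) (Fin 2)).symm
      ((Equiv.prodCongr (Equiv.sumCompl fun j : Fin 10 => j ∈ S) (Equiv.refl (Fin 2)))
        ((Equiv.sumProdDistrib _ _ (Fin 2)).symm
          ((Equiv.sumCongr (fpf.symm.trans (ep.prodCongr (Equiv.refl (Fin 2))))
              (fpf.symm.trans (em.prodCongr (Equiv.refl (Fin 2)))))
            (finSumFinEquiv.symm (Fin.castAdd 10 k))))) = _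
    rw [finSumFinEquiv_symm_apply_castAdd, Equiv.sumCongr_apply, Sum.map_inl, Equiv.trans_apply,
      Equiv.prodCongr_apply, Prod.map_apply, Equiv.sumProdDistrib_symm_apply_left,
      Equiv.prodCongr_apply, Prod.map_apply, Equiv.sumCompl_apply_inl]
    rfl
  refine ⟨τ, fun k => ?_, fun a => ?_⟩
  · rw [hτ]; exact (ep _).2
  · have hk0 : (⟨2 * (a : ℕ), by omega⟩ : Fin 10) = fpf (a, (0 : Fin 2)) :=
      Fin.ext (by change 2 * (a : ℕ) = ((0 : Fin 2) : ℕ) + 2 * (a : ℕ); simp)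
    have hk1 : (⟨2 * (a : ℕ) + 1, by omega⟩ : Fin 10) = fpf (a, (1 : Fin 2)) :=
      Fin.ext (by change 2 * (a : ℕ) + 1 = ((1 : Fin 2) : ℕ) + 2 * (a : ℕ); simp [add_comm])
    rw [hk0, hk1, hτ, hτ]
    simp only [Equiv.symm_apply_apply]

end NormAnchor

/-- **Registered sub-goal `stub_normAnchorPlanes` of crux stmt-HodgeConjecture-1262 (line
`quaternionic-norm-anchors`)**: on a complex abelian tenfold with `ψ¹¹ = 𝟙`, `Σ_{k<11} ψᵏ = 0`, every
eigenspace `ker(ψ^* - ζ^{j+1})` of `ψ^*` on `H¹` is a plane (`NormAnchor.finrank_U`).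
[cite: LangeBirkenhake1992, §13.1 and Prop. 1.1.9] -/
theorem stub_normAnchorPlanes : ∀ (A : AbelianVariety ℂ) (ψ : A ⟶ A), A.dim = 10 → (CategoryTheory.End.of ψ) ^ 11 = 1 → (Finset.range 11).sum (fun k => (CategoryTheory.End.of ψ) ^ k) = 0 → ∀ j : Fin 10, Module.finrank ℂ (Module.End.eigenspace (complexBetti.map ψ.hom.hom.hom 1).hom ((Complex.exp (2 * (Real.pi : ℂ) * Complex.I / 11)) ^ ((j : ℕ) + 1))) = 2 :=
  fun _ _ hA h11 hnorm j => NormAnchor.finrank_U hA h11 hnorm j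

end Summit.HodgeConjecture.HodgeConjecture.Theorems.HeckePrymWeil

end
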